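import Mathlib
import Literature.AlgebraicGeometry.HyperbolicPolynomials.HyperbolicityCone
import Literature.AlgebraicGeometry.HyperbolicPolynomials.Garding
import Literature.AlgebraicGeometry.HyperbolicPolynomials.SmoothBoundary
import Literature.AlgebraicGeometry.HyperbolicPolynomials.LineDerivatives
import Literature.Combinatorics.StablePolynomials.Basic
import Literature.Combinatorics.StablePolynomials.Limits
import Literature.Combinatorics.StablePolynomials.RayleighOfStable

/-!
# `PermanentalConeHard` (stmt-ValiantsHypothesis-8654) — the FLAG STEP for the witness cones

Route `PermanentalCones` of `ValiantsHypothesis`, crux `PermanentalConeHard` (H+).  The H+ witnesses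
are the closed hyperbolicity cones `Λ₊(Q, 𝟙)` of the permanental polynomials
`Q = per[(Y)_{rows<r}; x^{(n-r)}]`, `Y ≥ 0` entrywise; every such `Q` is a real stable, multi-affine
form with nonnegative coefficients (`PermanentalHyperbolic`).  For THIS class we prove a Renegar-type
nested description of the open cone through ONE coordinate derivative (a boundary direction of the
cone, where Renegar's `Λ₊₊(p) = {p > 0} ∩ Λ₊₊(D_e p)` is stated for the interior direction `e`):

* `openHyperbolicityCone_eq_inter_pderiv` — **flag step**: if `Q` is a real stable multi-affine
  form with nonnegative coefficients and `∂ⱼQ ≠ 0`, then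
  `Λ₊₊(Q, 𝟙) = {x : Q(x) > 0} ∩ Λ₊₊(∂ⱼQ, 𝟙)`.

Since `∂ⱼQ` is again in the class, iterating along any ordering of the variables describes
`Λ₊₊(Q, 𝟙)` by `deg Q` polynomial inequalities `∂_{j₁}⋯∂_{j_i}Q > 0`; equivalently `Λ₊(Q,𝟙)` is the
closed epigraph `{x_j ≥ -Q|_{x_j=0}/∂ⱼQ}` over `Λ₊(∂ⱼQ, 𝟙)` — the reformulation of the Easy horn
(item 8652, mixed-direction Saunderson–Parrilo) recorded in
`Cruxes/PermanentalConeHard/Lines/registered-dead.md`.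

Proof.  `⊆`: `Q > 0` on `Λ₊₊(Q)` (`eval_pos_of_mem`); and `∂ⱼQ ≠ 0` on `Λ₊₊(Q)`: if `∂ⱼQ(y) = 0`
then `Q` is constant `≠ 0` on the line `y + ℝeⱼ` (multi-affinity, `eval_add_single_eq`), so by
connectedness the half-line `u ≤ 0` stays in `Λ₊₊(Q)`; rescaling and closedness put `-eⱼ` in
`Λ₊(Q)`, contradicting the explicit zero `Q(τ₀𝟙 - eⱼ) = 0` at `τ₀ = ∂ⱼQ(𝟙)/Q(𝟙) > 0`.
`⊇`: along `t ↦ x + t𝟙` the quotient `H = Q/∂ⱼQ` has derivative `Σ_k Δ_{kj}(Q)/(∂ⱼQ)² ≥ 0` by the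
Rayleigh inequalities of real stable multi-affine polynomials (Brändén 2007, Thm 5.6;
`rayleighDiff_nonneg_of_isRealStable`), so `H(t) ≥ H(0) = Q(x)/∂ⱼQ(x) > 0` for `t ≥ 0`.

References: P. Brändén, Adv. Math. 216 (2007), Thm 5.6; J. Renegar, Found. Comput. Math. 6 (2006)
§2–4 (nested derivative cones); lead-c4 numerics `scratch/flagcheck.py` (13 500 sample points,
n ≤ 8, r ≤ 4: 0 mismatches).
-/

set_option linter.dupNamespace false

noncomputable section

namespace Summit.ValiantsHypothesis.ValiantsHypothesis.Theorems.PermanentalConesPermanentalConeHard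

open MvPolynomial Finset Filter Topology
open scoped BigOperators
open Literature.AlgebraicGeometry.HyperbolicPolynomials
open Literature.Combinatorics.StablePolynomials

variable {σ : Type*} [Fintype σ] [DecidableEq σ]

/-! ### Positivity of nonnegative-coefficient polynomials on the open orthant -/

omit [DecidableEq σ] in
/-- A nonzero polynomial with nonnegative coefficients is positive at every strictly positive
point. [folklore] -/
theorem eval_pos_of_coeff_nonneg {Q : MvPolynomial σ ℝ} (hcoef : ∀ m, 0 ≤ Q.coeff m) (hQ : Q ≠ 0)
    {z : σ → ℝ} (hz : ∀ k, 0 < z k) : 0 < MvPolynomial.eval z Q := by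
  rw [MvPolynomial.eval_eq']
  obtain ⟨m₀, hm₀⟩ := MvPolynomial.exists_coeff_ne_zero hQ
  have hmem : m₀ ∈ Q.support := by rwa [MvPolynomial.mem_support_iff]
  have hterm : ∀ m ∈ Q.support, 0 ≤ Q.coeff m * ∏ k, z k ^ m k := fun m _ =>
    mul_nonneg (hcoef m) (Finset.prod_nonneg fun k _ => pow_nonneg (hz k).le _)
  refine lt_of_lt_of_le ?_ (Finset.single_le_sum hterm hmem)
  exact mul_pos (lt_of_le_of_ne (hcoef m₀) (Ne.symm hm₀))
    (Finset.prod_pos fun k _ => pow_pos (hz k) _)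

omit [Fintype σ] [DecidableEq σ] in
/-- Partial derivatives keep nonnegative coefficients. [folklore] -/
theorem coeff_pderiv_nonneg {Q : MvPolynomial σ ℝ} (hcoef : ∀ m, 0 ≤ Q.coeff m) (j : σ)
    (m : σ →₀ ℕ) : 0 ≤ (pderiv j Q).coeff m := by
  rw [coeff_pderiv]
  exact mul_nonneg (hcoef _) (by positivity)

omit [Fintype σ] [DecidableEq σ] in
/-- Partial derivatives of forms of degree `d` are forms of degree `d - 1`. [folklore] -/
theorem isHomogeneous_pderiv' {Q : MvPolynomial σ ℝ} {d : ℕ} (hQ : Q.IsHomogeneous d) (j : σ) :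
    (pderiv j Q).IsHomogeneous (d - 1) := by
  intro γ hγ
  rw [coeff_pderiv] at hγ
  have h1 := hQ (left_ne_zero_of_mul hγ)
  have hw : Finsupp.weight (1 : σ → ℕ) (Finsupp.single j 1) = 1 := by
    simp [Finsupp.weight_single]
  rw [map_add, hw] at h1
  change Finsupp.weight 1 γ = d - 1
  omega

omit [Fintype σ] [DecidableEq σ] in
/-- If `∂ⱼQ ≠ 0` for a form `Q` of degree `d`, then `1 ≤ d`. [folklore] -/
theorem one_le_of_pderiv_ne_zero {Q : MvPolynomial σ ℝ} {d : ℕ} (hQ : Q.IsHomogeneous d) {j : σ}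
    (hj : pderiv j Q ≠ 0) : 1 ≤ d := by
  obtain ⟨m, hm⟩ := MvPolynomial.exists_coeff_ne_zero hj
  rw [coeff_pderiv] at hm
  have h1 := hQ (left_ne_zero_of_mul hm)
  have hw : Finsupp.weight (1 : σ → ℕ) (Finsupp.single j 1) = 1 := by
    simp [Finsupp.weight_single]
  rw [map_add, hw] at h1
  omega

/-- Real stability passes to nonzero partial derivatives. [cite: Wagner2011, Lemma 2.4 (f)] -/
theorem isRealStable_pderiv {Q : MvPolynomial σ ℝ} (hst : IsRealStable Q) {j : σ}
    (hj : pderiv j Q ≠ 0) : IsRealStable (pderiv j Q) := by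
  have h := IsUpperHalfPlaneStable.pderiv hst j
  rw [pderiv_map] at h
  rcases h with h0 | h
  · exact absurd (MvPolynomial.map_injective _ (RingHom.injective _) (by rw [h0, map_zero])) hj
  · exact h

/-! ### The class and its basic cone facts -/

section FlagStep

variable {Q : MvPolynomial σ ℝ} {d : ℕ}

omit [Fintype σ] [DecidableEq σ] in
/-- Translating a point of the open cone along `𝟙` keeps it in the open cone. [folklore] -/
theorem add_smul_mem_open_of_mem_open {f : MvPolynomial σ ℝ} {e x : σ → ℝ}
    (hx : x ∈ openHyperbolicityCone f e) {τ : ℝ} (hτ : 0 ≤ τ) :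
    x + τ • e ∈ openHyperbolicityCone f e := by
  intro τ' hτ'
  have := hx (τ + τ') (add_nonneg hτ hτ')
  rwa [add_smul, ← add_assoc] at this

/-- **`∂ⱼQ` does not vanish on the open cone** of a real stable multi-affine form `Q` with
nonnegative coefficients (when `∂ⱼQ ≠ 0`).  If `∂ⱼQ(y) = 0` then `Q` is constant on `y + ℝeⱼ`, the
half-line `u ≤ 0` stays in `Λ₊₊(Q)` by connectedness, and rescaling gives `-eⱼ ∈ Λ₊(Q)`, while
`Q(τ₀𝟙 - eⱼ) = 0` for `τ₀ = ∂ⱼQ(𝟙)/Q(𝟙) > 0`. [folklore] -/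
theorem eval_pderiv_ne_zero_of_mem_open (hhom : Q.IsHomogeneous d) (hma : IsMultiAffine Q)
    (hcoef : ∀ m, 0 ≤ Q.coeff m) (hst : IsRealStable Q) {j : σ} (hj : pderiv j Q ≠ 0)
    {y : σ → ℝ} (hy : y ∈ openHyperbolicityCone Q (fun _ => (1 : ℝ))) :
    MvPolynomial.eval y (pderiv j Q) ≠ 0 := by
  intro hP0
  set e : σ → ℝ := fun _ => (1 : ℝ) with he
  have hQ0 : Q ≠ 0 := fun h => hj (by rw [h, map_zero])
  have hQ1 : 0 < MvPolynomial.eval e Q := eval_pos_of_coeff_nonneg hcoef hQ0 (fun _ => one_pos)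
  have hP1 : 0 < MvPolynomial.eval e (pderiv j Q) :=
    eval_pos_of_coeff_nonneg (coeff_pderiv_nonneg hcoef j) hj (fun _ => one_pos)
  have hhyp : IsHyperbolic Q e := isHyperbolic_of_isRealStable hst (fun _ => one_pos) hQ1.ne'
  have hd : 1 ≤ d := one_le_of_pderiv_ne_zero hhom hj
  -- `Q` is constant along the `eⱼ`-line through `y`
  have hline : ∀ u : ℝ, MvPolynomial.eval (y + Pi.single j u) Q = MvPolynomial.eval y Q := by
    intro u
    rw [eval_add_single_eq (hma j), hP0, mul_zero, add_zero]
  have hQy : MvPolynomial.eval y Q ≠ 0 := eval_ne_zero_of_mem_openHyperbolicityCone hy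
  -- connectedness: the whole half-line `u ≤ 0` lies in the open cone
  set g : ℝ → σ → ℝ := fun u => y + Pi.single j u with hg
  have hgc : Continuous g := by
    refine continuous_const.add (continuous_pi fun k => ?_)
    by_cases hk : k = j
    · subst hk; simp only [Pi.single_eq_same]; exact continuous_id
    · simp only [Pi.single_eq_of_ne hk]; exact continuous_const
  have hopen : IsOpen (openHyperbolicityCone Q e) := hhyp.isOpen_openHyperbolicityCone hhom
  have hclosed : IsClosed (hyperbolicityCone Q e) := isClosed_hyperbolicityCone hhom hhyp
  have hsub : Set.Iic (0 : ℝ) ⊆ g ⁻¹' openHyperbolicityCone Q e := by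
    refine (isPreconnected_Iic).subset_left_of_subset_union (hopen.preimage hgc)
      (hclosed.isOpen_compl.preimage hgc) ?_ ?_ ?_
    · exact Set.disjoint_left.2 fun u hu hu' => hu' (openHyperbolicityCone_subset _ _ hu)
    · intro u _
      by_cases hmem : g u ∈ hyperbolicityCone Q e
      · left
        exact mem_openHyperbolicityCone_of_eval_ne_zero hmem (by rw [hg]; dsimp only; rw [hline u]; exact hQy)
      · right; exact hmem
    · exact ⟨0, Set.self_mem_Iic, by simpa [hg] using hy⟩
  -- rescaled points `(n+1)⁻¹ • y - eⱼ` of the closed cone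
  have hmem : ∀ n : ℕ, ((n : ℝ) + 1)⁻¹ • y + Pi.single j (-1 : ℝ) ∈ hyperbolicityCone Q e := by
    intro n
    have hn : (0 : ℝ) < (n : ℝ) + 1 := by positivity
    have hu : g (-((n : ℝ) + 1)) ∈ openHyperbolicityCone Q e :=
      hsub (Set.mem_Iic.2 (by linarith))
    have hsc := smul_mem_hyperbolicityCone hhom (openHyperbolicityCone_subset _ _ hu) (inv_pos.2 hn)
    have hpt : ((n : ℝ) + 1)⁻¹ • g (-((n : ℝ) + 1)) = ((n : ℝ) + 1)⁻¹ • y + Pi.single j (-1 : ℝ) := by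
      rw [hg]; dsimp only
      rw [smul_add]
      congr 1
      funext k
      by_cases hk : k = j
      · subst hk
        simp only [Pi.smul_apply, Pi.single_eq_same, smul_eq_mul]
        field_simp
      · simp [Pi.single_eq_of_ne hk]
    rwa [hpt] at hsc
  -- the limit `-eⱼ` lies in the closed cone
  have htend : Tendsto (fun n : ℕ => ((n : ℝ) + 1)⁻¹ • y + Pi.single j (-1 : ℝ)) atTop
      (𝓝 ((0 : ℝ) • y + Pi.single j (-1 : ℝ))) := by
    refine Tendsto.add_const _ (Tendsto.smul_const ?_ y)
    have h := tendsto_one_div_add_atTop_nhds_zero_nat (𝕜 := ℝ)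
    simpa [one_div] using h
  rw [zero_smul, zero_add] at htend
  have hneg : Pi.single j (-1 : ℝ) ∈ hyperbolicityCone Q e :=
    hclosed.mem_of_tendsto htend (Eventually.of_forall hmem)
  -- … but `Q(τ₀ 𝟙 - eⱼ) = 0` for `τ₀ = ∂ⱼQ(𝟙)/Q(𝟙) > 0`
  set τ₀ : ℝ := MvPolynomial.eval e (pderiv j Q) / MvPolynomial.eval e Q with hτ₀
  have hτ₀pos : 0 < τ₀ := div_pos hP1 hQ1
  refine hneg τ₀ hτ₀pos ?_
  obtain ⟨d', rfl⟩ : ∃ d', d = d' + 1 := ⟨d - 1, by omega⟩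
  have hhomP : (pderiv j Q).IsHomogeneous d' := by
    simpa using isHomogeneous_pderiv' hhom j
  rw [add_comm, eval_add_single_eq (hma j), hhom.eval_smul_eq, hhomP.eval_smul_eq, pow_succ]
  have hQ1' : MvPolynomial.eval e Q ≠ 0 := hQ1.ne'
  rw [hτ₀]
  field_simp
  ring

/-- **FLAG STEP.**  For a real stable multi-affine form `Q` with nonnegative coefficients and
`∂ⱼQ ≠ 0`: `Λ₊₊(Q, 𝟙) = {x : Q(x) > 0} ∩ Λ₊₊(∂ⱼQ, 𝟙)` — the open hyperbolicity cone is cut out of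
the (larger) open cone of the coordinate derivative by the single inequality `Q > 0`.
[cite: Branden2007, §5, Theorem 5.6] -/
theorem openHyperbolicityCone_eq_inter_pderiv (hhom : Q.IsHomogeneous d) (hma : IsMultiAffine Q)
    (hcoef : ∀ m, 0 ≤ Q.coeff m) (hst : IsRealStable Q) {j : σ} (hj : pderiv j Q ≠ 0) :
    openHyperbolicityCone Q (fun _ => (1 : ℝ)) =
      {x | 0 < MvPolynomial.eval x Q} ∩ openHyperbolicityCone (pderiv j Q) (fun _ => (1 : ℝ)) := by
  have hQ0 : Q ≠ 0 := fun h => hj (by rw [h, map_zero])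
  set e : σ → ℝ := fun _ => (1 : ℝ) with he
  set P : MvPolynomial σ ℝ := pderiv j Q with hP
  have hQ1 : 0 < MvPolynomial.eval e Q := eval_pos_of_coeff_nonneg hcoef hQ0 (fun _ => one_pos)
  have hPcoef : ∀ m, 0 ≤ P.coeff m := coeff_pderiv_nonneg hcoef j
  have hP1 : 0 < MvPolynomial.eval e P := eval_pos_of_coeff_nonneg hPcoef hj (fun _ => one_pos)
  have hQhyp : IsHyperbolic Q e := isHyperbolic_of_isRealStable hst (fun _ => one_pos) hQ1.ne'
  have hPst : IsRealStable P := isRealStable_pderiv hst hj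
  have hPhyp : IsHyperbolic P e := isHyperbolic_of_isRealStable hPst (fun _ => one_pos) hP1.ne'
  have hPhom : P.IsHomogeneous (d - 1) := isHomogeneous_pderiv' hhom j
  have hPma : IsMultiAffine P := isMultiAffine_pderiv hma j
  ext x
  constructor
  · -- `⊆`
    intro hx
    refine ⟨eval_pos_of_mem hhom hQhyp hQ1 hx, fun τ hτ => ?_⟩
    exact eval_pderiv_ne_zero_of_mem_open hhom hma hcoef hst hj (add_smul_mem_open_of_mem_open hx hτ)
  · -- `⊇`: monotonicity of `H(t) = Q(x + t𝟙)/∂ⱼQ(x + t𝟙)` on `t ≥ 0`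
    rintro ⟨hQx, hxP⟩ τ hτ
    -- the two line polynomials
    set a : Polynomial ℝ := linePoly Q x e with ha
    set b : Polynomial ℝ := linePoly P x e with hb
    have hbpos : ∀ t : ℝ, 0 ≤ t → 0 < b.eval t := fun t ht => by
      rw [hb, eval_linePoly]
      exact eval_pos_of_mem hPhom hPhyp hP1 (add_smul_mem_open_of_mem_open hxP ht)
    -- derivatives of the line polynomials are sums of partial derivatives
    have hda : ∀ t : ℝ, (Polynomial.derivative a).eval t =
        ∑ k, MvPolynomial.eval (x + t • e) (pderiv k Q) := fun t => by
      rw [ha, derivative_linePoly, eval_linePoly, map_sum]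
      exact Finset.sum_congr rfl fun k _ => by rw [he]; simp
    have hdb : ∀ t : ℝ, (Polynomial.derivative b).eval t =
        ∑ k, MvPolynomial.eval (x + t • e) (pderiv k P) := fun t => by
      rw [hb, derivative_linePoly, eval_linePoly, map_sum]
      exact Finset.sum_congr rfl fun k _ => by rw [he]; simp
    -- the Rayleigh numerator
    have hnum : ∀ t : ℝ, 0 ≤ (Polynomial.derivative a).eval t * b.eval t -
        a.eval t * (Polynomial.derivative b).eval t := by
      intro t
      have hsum : (Polynomial.derivative a).eval t * b.eval t -
          a.eval t * (Polynomial.derivative b).eval t =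
          ∑ k, MvPolynomial.eval (x + t • e) (rayleighDiff k j Q) := by
        rw [hda, hdb, ha, hb, eval_linePoly, eval_linePoly, Finset.sum_mul, Finset.mul_sum,
          ← Finset.sum_sub_distrib]
        refine Finset.sum_congr rfl fun k _ => ?_
        simp only [rayleighDiff, map_sub, map_mul, hP]
        ring
      rw [hsum]
      exact Finset.sum_nonneg fun k _ => rayleighDiff_nonneg_of_isRealStable hma hst _ k j
    -- the quotient `H = a/b` is monotone on `[0, ∞)`
    set H : ℝ → ℝ := fun t => a.eval t / b.eval t with hH
    have hderiv : ∀ t : ℝ, 0 ≤ t → HasDerivAt H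
        (((Polynomial.derivative a).eval t * b.eval t - a.eval t * (Polynomial.derivative b).eval t) /
          (b.eval t) ^ 2) t := fun t ht =>
      (a.hasDerivAt t).div (b.hasDerivAt t) (hbpos t ht).ne'
    have hmono : MonotoneOn H (Set.Ici 0) := by
      refine monotoneOn_of_deriv_nonneg (convex_Ici 0) ?_ ?_ ?_
      · exact (a.continuous.continuousOn).div (b.continuous.continuousOn)
          (fun t ht => (hbpos t ht).ne')
      · rw [interior_Ici]
        exact fun t ht => ((hderiv t (le_of_lt ht)).differentiableAt).differentiableWithinAt
      · rw [interior_Ici]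
        intro t ht
        rw [(hderiv t (le_of_lt ht)).deriv]
        exact div_nonneg (hnum t) (sq_nonneg _)
    have hH0 : 0 < H 0 := by
      rw [hH]; dsimp only
      refine div_pos ?_ (hbpos 0 le_rfl)
      rw [ha, eval_linePoly]; simpa using hQx
    have hHτ : 0 < H τ := lt_of_lt_of_le hH0 (hmono Set.self_mem_Ici (Set.mem_Ici.2 hτ) hτ)
    have hval : MvPolynomial.eval (x + τ • e) Q = H τ * b.eval τ := by
      rw [hH]; dsimp only
      rw [div_mul_cancel₀ _ (hbpos τ hτ).ne', ha, eval_linePoly]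
    rw [hval]
    exact (mul_pos hHτ (hbpos τ hτ)).ne'

/-- **Flag step, closed-cone form.**  Under the same hypotheses,
`Λ₊(Q, 𝟙) = {x : Q(x + τ𝟙) > 0 ∀ τ > 0} ∩ Λ₊(∂ⱼQ, 𝟙)` (apply the open form to the points
`x + τ𝟙 ∈ Λ₊₊`). [cite: Branden2007, §5, Theorem 5.6] -/
theorem hyperbolicityCone_eq_inter_pderiv (hhom : Q.IsHomogeneous d) (hma : IsMultiAffine Q)
    (hcoef : ∀ m, 0 ≤ Q.coeff m) (hst : IsRealStable Q) {j : σ} (hj : pderiv j Q ≠ 0) :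
    hyperbolicityCone Q (fun _ => (1 : ℝ)) =
      {x | ∀ τ : ℝ, 0 < τ → 0 < MvPolynomial.eval (x + τ • fun _ => (1 : ℝ)) Q} ∩
        hyperbolicityCone (pderiv j Q) (fun _ => (1 : ℝ)) := by
  have hopen := openHyperbolicityCone_eq_inter_pderiv hhom hma hcoef hst hj
  ext x
  constructor
  · intro hx
    have hxτ : ∀ τ : ℝ, 0 < τ → x + τ • (fun _ => (1 : ℝ)) ∈
        {x | 0 < MvPolynomial.eval x Q} ∩ openHyperbolicityCone (pderiv j Q) (fun _ => (1 : ℝ)) :=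
      fun τ hτ => hopen ▸ add_smul_mem_openHyperbolicityCone hx hτ
    refine ⟨fun τ hτ => (hxτ τ hτ).1, fun τ hτ => ?_⟩
    exact eval_ne_zero_of_mem_openHyperbolicityCone (hxτ τ hτ).2
  · rintro ⟨hQx, hxP⟩ τ hτ
    have hmem : x + τ • (fun _ => (1 : ℝ)) ∈ openHyperbolicityCone Q (fun _ => (1 : ℝ)) := by
      rw [hopen]
      exact ⟨hQx τ hτ, add_smul_mem_openHyperbolicityCone hxP hτ⟩
    exact eval_ne_zero_of_mem_openHyperbolicityCone hmem

end FlagStep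


/-- **Registered form** (`stub_flagStep` on stmt-ValiantsHypothesis-8654): the flag step for real
stable multi-affine forms with nonnegative coefficients, verbatim signature. -/
theorem stub_flagStep : ∀ (σ : Type) [Fintype σ] [DecidableEq σ] (Q : MvPolynomial σ ℝ) (d : ℕ), Q.IsHomogeneous d → Literature.Combinatorics.StablePolynomials.IsMultiAffine Q → (∀ m, 0 ≤ Q.coeff m) → Literature.Combinatorics.StablePolynomials.IsRealStable Q → ∀ j : σ, MvPolynomial.pderiv j Q ≠ 0 → Literature.AlgebraicGeometry.HyperbolicPolynomials.openHyperbolicityCone Q (fun _ => (1 : ℝ)) = {x | 0 < MvPolynomial.eval x Q} ∩ Literature.AlgebraicGeometry.HyperbolicPolynomials.openHyperbolicityCone (MvPolynomial.pderiv j Q) (fun _ => (1 : ℝ)) := by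
  intro σ _ _ Q d hhom hma hcoef hst j hj
  exact openHyperbolicityCone_eq_inter_pderiv hhom hma hcoef hst hj

end Summit.ValiantsHypothesis.ValiantsHypothesis.Theorems.PermanentalConesPermanentalConeHard
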